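/- Copyright: the b2b-balaban cell (near-miss cell 7), T⁴-continuum fan-out, lineage t4-ne7b-p1 (node U5c COUNT
member).  Released under the licence of the surrounding project. -/
import Summits.QuantumFields.BalabanUV.T4Continuum.Support.HistoryAdmissible

/-!
# Genealogy extraction (H3-(ID), combinatorial half, part 1): print's LEVEL-INDEXED component bookkeeping, as DATA,
determines the pending-component histories `PGen` of `HistoryAdmissible` — the data, the map and its one-step equations
(owner module of row NE7b, lineage `t4-ne7b-p1` gen 39, ruling R-OWNER-39-1; re-open object (α) of
`WALL-NE7b-P1.md` §4 (i)∕(v), `SCOPE-alpha.md` §2 row 2 — PRE-POSITIONING ONLY; part 1 of 5)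

Summits-side support leaf of the T⁴-continuum cell (rung (B)+1 on a FINITE torus only; NOT infinite volume, NOT the
mass gap, NOT the Clay statement; NOT a proof of the spine estimate NE7b, which is the cell's OWN estimate, NOT PRINTED
and NOT PROVED).  [folklore] finite combinatorics over the lineage's own carrier `HistoryAdmissible.PGen`; nothing
printed is asserted, no `def … : Prop` fact of Bałaban's, no cite-tagged hypothesis, zero `sorry`.
B16 = [Balaban1989LargeFieldII] pp. 381–387 is a manuscript UNDER AUDIT; the sentences quoted below only LOCATE which
printed bookkeeping each field models (certified reading C-B16-6, page table `t4/T4-XREAD-NE7b-READING.md`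
V1–V6∕D1–D7; F-T4-47∕-49∕-106∕-173 of `t4/CITED-FACTS-T4.md`); they are never used as establishing a disputed step.

WHY.  The wall of row NE7b (`WALL-NE7b-P1.md` v1.12 §2) is the READING H3: the class-R field `realised` of the headline
witness `CountRoadWitnessT3b` says «the terms' live structures ARE realised pending pedigrees with domains».  Print
never indexes the density by pedigrees: (2.18) [III] ∕ (1.72) index it by ADMISSIBLE SEQUENCES of large-field regions
`{Ω^c_j, Z_j}`, level by level, and pp. 383–387 DESCRIBE the history of a component inductively — «Let us consider the
(j+1)-th step and a component Z of Z_{j+1}. If no new large fields were created, then Z = S(Z₀) for some component Z₀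
of Z_j» ((1.83) p. 385), «Z₀ satisfies the conditions (i), (ii), and a new large field was introduced in the preparatory
operations … hence K = R_{j+1} for Z» (p. 386 ll. 1–3), «Z is obtained from some number of components of Z_j, and some
number of new large field regions, joined together into the one component of Z_{j+1} by the operations of the last
step» (p. 386 ll. 3–6, (1.84)–(1.87) along «a maximal tree graph contained in the graph G»), every new component lying
in «Z′^{~10}_{j−1} ∪ ⋃_i (Z_j^{(i)})^{~2}» ((1.76) p. 381).  `SCOPE-alpha.md` §2 row 2 records that turning (ID) into
a THEOREM needs exactly this bookkeeping AS DATA.  This module types the data ABSTRACTLY (labels, no geometry) and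
EXTRACTS the genealogies; the geometric layer and the junction to `RealisedDomainsR` are the separate modules M3b ∕ M4
of SCOPE-alpha v2.  BY-NAME EFFECT ON THE WALL: NONE today (pre-positioning for (α)).

WHAT IS TYPED (§1).  `ComponentHistory γ`: per level `j` the finite set `comp j` of components of `Z_j` and the finite
set `newReg j` of new large-field regions created in the preparatory operations of step `j` (each with its class
`cls`, the `d′_j` of the factor on p. 381); per component `c ∈ comp j` ONE LIST `constit j c` of its constituents —
old components `Sum.inl p` (of `comp (j−1)`) it continues and new regions `Sum.inr n` (of `newReg j`) it contains — in
the LEAF-FIRST order of print's maximal tree (p. 386: endpoint `X`, rest `Y`, recursively; each constituent is to touch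
the union of the LATER ones — the join clause of row S1b's `HistoryRealise.Realises`; old and new constituents may
interleave), with projections `parts j c`, `news j c`; and the flag `fieldIn j c` («a new large field was introduced in
the preparatory operations» inside a component continued ALONE — the renewal trigger of p. 386 ll. 1–3).  `WF`: the
printed side conditions as axioms of the abstract data — `parts 0 · = []`; `parts`∕`news` duplicate-free, landing in the
previous components ∕ the step's new regions; every component has a constituent ((1.76)); distinct components of one
level continue DISJOINT sets of old components and contain DISJOINT sets of new regions (components of `Z_j` are disjoint).
WHAT IS DEFINED AND PROVED.  §2 `pgen H j c : PGen γ` — THE EXTRACTION, by recursion on the level: the constituents of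
`c` in the listed order (the genealogy of an old part `p`; `birth j (cls n) n` for a new region `n`) are assembled by
print's trichotomy: ONE old part, no new region, no new field ↦ the part's genealogy unchanged (no
event, (1.83)); ONE old part, no new region, a new field ↦ `renew _ (j−1)` (event at `j`); otherwise (≥ 2 constituents,
or a lone new region) ↦ the right-nested binary `join … j` chain of the constituents (`joinTail`; print's binarisation
along the maximal tree — the ORDER of the constituents is part of the data, which is why `constit` is a LIST) ∕ the
lone birth; at level `0` nothing is continued and only births are assembled.  One-step EQUATIONS:
`pgen_succ_noEvent`, `pgen_succ_renew`, `pgen_succ_birth`, `pgen_zero_birth`, `pgen_succ_eq_assemble`; the constituent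
list's length ∕ membership ∕ product ∕ sum splits into `parts` and `news`.  Siblings: `…Timing` (print's discipline
`Adm` for every extracted genealogy), `…Ledger` (event products, partition), `…Count`, `…Ancestors`.

HONEST.  Proves nothing of Bałaban's; the identification of `ComponentHistory` data with the admissible sequences of
(2.18) [III]∕(1.72) for Bałaban's densities is the geometric half of (ID) and is NOT here; NE7b NOT proved; spine 0∕9.
HONEST DEPENDENCY (cell): continuum YM on T⁴ ⇐ BetaPertH ∧ nine spine estimates (0/9 proved); BetaPertH ⇐ (D1) ∧ (D4)
∧ CAP+tail; G-an2-4 gates asym, D1 and NE2/3/4.  This file changes none of it. -/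

open Finset
open Literature.MathematicalPhysics.QuantumFieldTheory.Balaban1983to89

namespace Summit.QuantumFields.BalabanUV.T4Continuum.HistoryGenealogyExtraction

open HistoryAdmissible HistoryAdmissible.PGen

/-! ## §1 Print's level-indexed component bookkeeping, as data -/

/-- **PRINT'S COMPONENT BOOKKEEPING AS DATA** (abstract labels `γ`, no geometry): `comp j` = the components of the
large-field region `Z_j`; `newReg j` = the new large-field regions created in the preparatory operations of step `j`
(«the fundamental large field factors» per `Z_j^{(i)}`, p. 381), `cls n` = the class `d′` of region `n`; for a component
`c ∈ comp j`: `constit j c` = its constituents — `Sum.inl p` for a component `p` of `Z_{j−1}` continued into `c`,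
`Sum.inr n` for a new region `n` of step `j` inside `c` ((1.76): «Z_j ⊂ Z′^{~10}_{j−1} ∪ ⋃_i (Z_j^{(i)})^{~2}») — listed
LEAF-FIRST along print's maximal tree (p. 386; the projections are `parts`, `news`); `fieldIn j c` = a new large field
was introduced inside the (single) continued component in the preparatory operations (p. 386 ll. 1–3). [folklore] -/
structure ComponentHistory (γ : Type*) where
  /-- components of `Z_j` -/
  comp : ℕ → Finset γ
  /-- new large-field regions created at step `j` -/
  newReg : ℕ → Finset γ
  /-- the class `d′` of a new region at birth -/
  cls : γ → ℕ
  /-- the constituents of a component of level `j` in leaf-first maximal-tree order: `Sum.inl p` = an old component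
  `p` of level `j − 1` continued into it, `Sum.inr n` = a new region `n` of step `j` inside it -/
  constit : ℕ → γ → List (γ ⊕ γ)
  /-- renewal trigger: a new large field inside a component continued alone -/
  fieldIn : ℕ → γ → Bool

/-! ### The two projections of a constituent list -/

section SumLists

variable {α β : Type*}

/-- the left entries of a list over a sum type, in order [folklore] -/
def lefts : List (α ⊕ β) → List α
  | [] => []
  | Sum.inl a :: L => a :: lefts L
  | Sum.inr _ :: L => lefts L

/-- the right entries of a list over a sum type, in order [folklore] -/
def rights : List (α ⊕ β) → List β
  | [] => []
  | Sum.inl _ :: L => rights L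
  | Sum.inr b :: L => b :: rights L

/-- `lefts` of the empty list [folklore] -/
@[simp] theorem lefts_nil : lefts ([] : List (α ⊕ β)) = [] := rfl
/-- `lefts` past a left entry [folklore] -/
@[simp] theorem lefts_cons_inl (a : α) (L : List (α ⊕ β)) : lefts (Sum.inl a :: L) = a :: lefts L := rfl
/-- `lefts` past a right entry [folklore] -/
@[simp] theorem lefts_cons_inr (b : β) (L : List (α ⊕ β)) : lefts (Sum.inr b :: L) = lefts L := rfl
/-- `rights` of the empty list [folklore] -/
@[simp] theorem rights_nil : rights ([] : List (α ⊕ β)) = [] := rfl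
/-- `rights` past a left entry [folklore] -/
@[simp] theorem rights_cons_inl (a : α) (L : List (α ⊕ β)) : rights (Sum.inl a :: L) = rights L := rfl
/-- `rights` past a right entry [folklore] -/
@[simp] theorem rights_cons_inr (b : β) (L : List (α ⊕ β)) : rights (Sum.inr b :: L) = b :: rights L := rfl

/-- the two projections exhaust the list [folklore] -/
theorem length_lefts_add_length_rights : ∀ L : List (α ⊕ β), (lefts L).length + (rights L).length = L.length
  | [] => rfl
  | Sum.inl a :: L => by
      have ih := length_lefts_add_length_rights L
      simp only [lefts_cons_inl, rights_cons_inl, List.length_cons]; omega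
  | Sum.inr b :: L => by
      have ih := length_lefts_add_length_rights L
      simp only [lefts_cons_inr, rights_cons_inr, List.length_cons]; omega

/-- membership in `lefts` [folklore] -/
theorem mem_lefts_iff (a : α) : ∀ L : List (α ⊕ β), a ∈ lefts L ↔ Sum.inl a ∈ L
  | [] => by simp
  | Sum.inl a' :: L => by simp [mem_lefts_iff a L]
  | Sum.inr b :: L => by simp [mem_lefts_iff a L]

/-- membership in `rights` [folklore] -/
theorem mem_rights_iff (b : β) : ∀ L : List (α ⊕ β), b ∈ rights L ↔ Sum.inr b ∈ L
  | [] => by simp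
  | Sum.inl a :: L => by simp [mem_rights_iff b L]
  | Sum.inr b' :: L => by simp [mem_rights_iff b L]

/-- a product over a sum-typed list splits into the two projections (commutativity absorbs the interleaving)
[folklore] -/
theorem prod_map_sum_elim {M : Type*} [CommMonoid M] (f : α → M) (g : β → M) :
    ∀ L : List (α ⊕ β), (L.map (Sum.elim f g)).prod = ((lefts L).map f).prod * ((rights L).map g).prod
  | [] => by simp
  | Sum.inl a :: L => by simp [prod_map_sum_elim f g L, mul_assoc]
  | Sum.inr b :: L => by simp [prod_map_sum_elim f g L, mul_left_comm]

/-- a sum over a sum-typed list splits into the two projections [folklore] -/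
theorem sum_map_sum_elim {M : Type*} [AddCommMonoid M] (f : α → M) (g : β → M) :
    ∀ L : List (α ⊕ β), (L.map (Sum.elim f g)).sum = ((lefts L).map f).sum + ((rights L).map g).sum
  | [] => by simp
  | Sum.inl a :: L => by simp [sum_map_sum_elim f g L, add_assoc]
  | Sum.inr b :: L => by simp [sum_map_sum_elim f g L, add_left_comm]

end SumLists

namespace ComponentHistory

variable {γ : Type*}

/-- the old components continued into component `c` of level `j` (left projection of `constit`) [folklore] -/
def parts (H : ComponentHistory γ) (j : ℕ) (c : γ) : List γ := lefts (H.constit j c)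

/-- the new regions of step `j` inside component `c` (right projection of `constit`) [folklore] -/
def news (H : ComponentHistory γ) (j : ℕ) (c : γ) : List γ := rights (H.constit j c)

variable [DecidableEq γ]

/-- **THE PRINTED SIDE CONDITIONS** of the bookkeeping, as axioms of the abstract data: nothing is continued into
level `0`; the lists are duplicate-free; parts are previous components, news are the step's new regions; every
component comes from at least one constituent ((1.76)); distinct components of one level continue disjoint sets of
old components and contain disjoint sets of new regions (components of `Z_j` are disjoint; an old component ∕ a new
region lies in at most one of them). [folklore] -/
structure WF (H : ComponentHistory γ) : Prop where
  /-- nothing is continued into level `0` -/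
  parts_zero : ∀ c, H.parts 0 c = []
  /-- the parts list is duplicate-free -/
  parts_nodup : ∀ j c, (H.parts j c).Nodup
  /-- the news list is duplicate-free -/
  news_nodup : ∀ j c, (H.news j c).Nodup
  /-- parts are components of the previous level -/
  parts_sub : ∀ j c, c ∈ H.comp (j + 1) → ∀ p ∈ H.parts (j + 1) c, p ∈ H.comp j
  /-- news are new regions of the same step -/
  news_sub : ∀ j c, c ∈ H.comp j → ∀ n ∈ H.news j c, n ∈ H.newReg j
  /-- every component has a constituent -/
  nonempty : ∀ j c, c ∈ H.comp j → H.constit j c ≠ []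
  /-- distinct components continue disjoint sets of old components -/
  parts_disj : ∀ j c c', c ∈ H.comp (j + 1) → c' ∈ H.comp (j + 1) → c ≠ c' →
    Disjoint (H.parts (j + 1) c).toFinset (H.parts (j + 1) c').toFinset
  /-- distinct components contain disjoint sets of new regions -/
  news_disj : ∀ j c c', c ∈ H.comp j → c' ∈ H.comp j → c ≠ c' →
    Disjoint (H.news j c).toFinset (H.news j c').toFinset

end ComponentHistory

/-! ## §2 The extraction `pgen` and its one-step equations -/

section Assembly

variable {γ : Type*}

/-- The right-nested binary join chain of a head constituent with a list of further constituents at step `s`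
(print's maximal-tree binarisation of a join, p. 386: endpoint `X`, rest `Y`, recursively). [folklore] -/
def joinTail : PGen γ → List (PGen γ) → ℕ → PGen γ
  | T, [], _ => T
  | T, U :: L, s => PGen.join T (joinTail U L s) s

/-- `joinTail` with no further constituent is the head [folklore] -/
@[simp] theorem joinTail_nil (T : PGen γ) (s : ℕ) : joinTail T [] s = T := rfl

/-- `joinTail` with a further constituent is a join at `s` [folklore] -/
@[simp] theorem joinTail_cons (T U : PGen γ) (L : List (PGen γ)) (s : ℕ) :
    joinTail T (U :: L) s = PGen.join T (joinTail U L s) s := rfl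

/-- **PRINT'S TRICHOTOMY** on the list of constituents of a component of level `s` (event step `s`, readiness step
`h = s − 1`): no constituent ↦ a junk birth (excluded by `WF.nonempty`); exactly one constituent ↦ itself, or — if it is
a continued component with the renewal trigger (`ren = true`) — `renew _ h`; at least two ↦ the join chain at `s` (a
preparatory-step field inside a MERGING constituent is not booked as an event: its printed factor `exp(−p₀(g_j))` of
(1.79)'s `Π′` is then surplus credit — harmless for upper bounds, as in `T4BankedInduction` (merger credit `0`)). [folklore] -/
def assemble (c : γ) (s h : ℕ) : List (PGen γ) → Bool → PGen γ
  | [], _ => PGen.birth s 0 c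
  | [T], ren => if ren = true then PGen.renew T h else T
  | T :: U :: L, _ => joinTail T (U :: L) s

/-- `assemble` on a singleton [folklore] -/
@[simp] theorem assemble_singleton (c : γ) (s h : ℕ) (T : PGen γ) (ren : Bool) :
    assemble c s h [T] ren = if ren = true then PGen.renew T h else T := rfl

/-- `assemble` on at least two constituents [folklore] -/
@[simp] theorem assemble_cons_cons (c : γ) (s h : ℕ) (T U : PGen γ) (L : List (PGen γ)) (ren : Bool) :
    assemble c s h (T :: U :: L) ren = joinTail T (U :: L) s := rfl

end Assembly

namespace ComponentHistory

variable {γ : Type*} (H : ComponentHistory γ)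

/-- The births of the new regions of step `s` inside component `c`, in the listed order. [folklore] -/
def births (s : ℕ) (c : γ) : List (PGen γ) :=
  (H.news s c).map fun n => PGen.birth s (H.cls n) n

/-- The constituents of component `c` of level `s`, in the listed order: the genealogy (`rec`) of an old part, the
birth of a new region. [folklore] -/
def constituents (rec : γ → PGen γ) (s : ℕ) (c : γ) : List (PGen γ) :=
  (H.constit s c).map (Sum.elim rec fun n => PGen.birth s (H.cls n) n)

/-- The renewal trigger READ: no new region inside and a new field inside. [folklore] -/
def ren [DecidableEq γ] (s : ℕ) (c : γ) : Bool := decide (H.news s c = []) && H.fieldIn s c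

variable [DecidableEq γ]

/-- **THE EXTRACTION**: the genealogy of component `c` of level `j`, by recursion on the level; at level `0` nothing
is continued, only births are assembled. [folklore] -/
def pgen : ℕ → γ → PGen γ
  | 0, c => assemble c 0 0 (H.births 0 c) false
  | j + 1, c => assemble c (j + 1) j (H.constituents (pgen j) (j + 1) c) (H.ren (j + 1) c)

/-- the defining equation at a successor level [folklore] -/
theorem pgen_succ_eq_assemble (j : ℕ) (c : γ) :
    H.pgen (j + 1) c = assemble c (j + 1) j (H.constituents (H.pgen j) (j + 1) c) (H.ren (j + 1) c) := rfl

/-- the defining equation at level `0` [folklore] -/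
theorem pgen_zero_eq_assemble (c : γ) : H.pgen 0 c = assemble c 0 0 (H.births 0 c) false := rfl

omit [DecidableEq γ] in
/-- length of the births list = number of new regions inside [folklore] -/
@[simp] theorem length_births (s : ℕ) (c : γ) : (H.births s c).length = (H.news s c).length := by
  simp [births]

omit [DecidableEq γ] in
/-- length of the constituents list = number of parts + number of new regions [folklore] -/
theorem length_constituents (rec : γ → PGen γ) (s : ℕ) (c : γ) :
    (H.constituents rec s c).length = (H.parts s c).length + (H.news s c).length := by
  simp only [constituents, List.length_map, parts, news, length_lefts_add_length_rights]

omit [DecidableEq γ] in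
/-- MEMBERSHIP in the constituents list: the genealogy of a part, or a birth [folklore] -/
theorem mem_constituents_iff (rec : γ → PGen γ) (s : ℕ) (c : γ) (U : PGen γ) :
    U ∈ H.constituents rec s c ↔ (∃ p ∈ H.parts s c, rec p = U) ∨ U ∈ H.births s c := by
  simp only [constituents, births, parts, news, List.mem_map, mem_lefts_iff, mem_rights_iff]
  constructor
  · rintro ⟨x, hx, rfl⟩
    cases x with
    | inl p => exact Or.inl ⟨p, hx, rfl⟩
    | inr n => exact Or.inr ⟨n, hx, rfl⟩
  · rintro (⟨p, hp, rfl⟩ | ⟨n, hn, rfl⟩)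
    · exact ⟨Sum.inl p, hp, rfl⟩
    · exact ⟨Sum.inr n, hn, rfl⟩

omit [DecidableEq γ] in
/-- a product over the constituents splits: parts' values times births' values [folklore] -/
theorem prod_map_constituents {M : Type*} [CommMonoid M] (f : PGen γ → M) (rec : γ → PGen γ) (s : ℕ) (c : γ) :
    ((H.constituents rec s c).map f).prod =
      ((H.parts s c).map fun p => f (rec p)).prod * ((H.news s c).map fun n => f (PGen.birth s (H.cls n) n)).prod := by
  simp only [constituents, parts, news, List.map_map]
  rw [show f ∘ Sum.elim rec (fun n => PGen.birth s (H.cls n) n) =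
      Sum.elim (fun p => f (rec p)) (fun n => f (PGen.birth s (H.cls n) n)) from
    funext fun x => by cases x <;> rfl]
  exact prod_map_sum_elim _ _ _

omit [DecidableEq γ] in
/-- a sum over the constituents splits: parts' values plus births' values [folklore] -/
theorem sum_map_constituents {M : Type*} [AddCommMonoid M] (f : PGen γ → M) (rec : γ → PGen γ) (s : ℕ) (c : γ) :
    ((H.constituents rec s c).map f).sum =
      ((H.parts s c).map fun p => f (rec p)).sum + ((H.news s c).map fun n => f (PGen.birth s (H.cls n) n)).sum := by
  simp only [constituents, parts, news, List.map_map]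
  rw [show f ∘ Sum.elim rec (fun n => PGen.birth s (H.cls n) n) =
      Sum.elim (fun p => f (rec p)) (fun n => f (PGen.birth s (H.cls n) n)) from
    funext fun x => by cases x <;> rfl]
  exact sum_map_sum_elim _ _ _

/-- under `WF` the constituents list of a component is nonempty [folklore] -/
theorem constituents_ne_nil (hW : H.WF) (rec : γ → PGen γ) {s : ℕ} {c : γ} (hc : c ∈ H.comp s) :
    H.constituents rec s c ≠ [] := by
  simpa [constituents] using hW.nonempty s c hc

/-- under `WF` the births list of a level-`0` component is nonempty [folklore] -/
theorem births_zero_ne_nil (hW : H.WF) {c : γ} (hc : c ∈ H.comp 0) : H.births 0 c ≠ [] := by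
  intro h
  have hl := congrArg List.length h
  rw [length_births, List.length_nil] at hl
  have h0 : (H.parts 0 c).length = 0 := by rw [hW.parts_zero c]; rfl
  have hsum := length_lefts_add_length_rights (H.constit 0 c)
  have hne := List.length_pos_of_ne_nil (hW.nonempty 0 c hc)
  simp only [parts] at h0
  simp only [news] at hl
  omega

/-- **NO EVENT** ((1.83) p. 385): one old part `p` and nothing else, no new field ↦ the part's genealogy, unchanged.
[folklore] -/
theorem pgen_succ_noEvent (j : ℕ) (c p : γ) (hp : H.constit (j + 1) c = [Sum.inl p])
    (hf : H.fieldIn (j + 1) c = false) : H.pgen (j + 1) c = H.pgen j p := by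
  rw [pgen_succ_eq_assemble]
  simp [constituents, ren, news, hp, hf]

/-- **RENEWAL** (p. 386 ll. 1–3): one old part `p` and nothing else, a new field inside ↦ `renew (pgen j p) j` (the
event sits at step `j + 1`). [folklore] -/
theorem pgen_succ_renew (j : ℕ) (c p : γ) (hp : H.constit (j + 1) c = [Sum.inl p])
    (hf : H.fieldIn (j + 1) c = true) : H.pgen (j + 1) c = PGen.renew (H.pgen j p) j := by
  rw [pgen_succ_eq_assemble]
  simp [constituents, ren, news, hp, hf]

/-- **BIRTH** of a lone new region `n` as its own component (a bare region, (1.82)∕p. 385) ↦ `birth (j+1) (cls n) n`.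
[folklore] -/
theorem pgen_succ_birth (j : ℕ) (c n : γ) (hn : H.constit (j + 1) c = [Sum.inr n]) :
    H.pgen (j + 1) c = PGen.birth (j + 1) (H.cls n) n := by
  rw [pgen_succ_eq_assemble]
  have : H.ren (j + 1) c = false := by simp [ren, news, hn]
  simp [constituents, hn, this]

/-- birth at level `0` of a lone new region [folklore] -/
theorem pgen_zero_birth (c n : γ) (hn : H.constit 0 c = [Sum.inr n]) : H.pgen 0 c = PGen.birth 0 (H.cls n) n := by
  rw [pgen_zero_eq_assemble]
  simp [births, news, hn]

end ComponentHistory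

end Summit.QuantumFields.BalabanUV.T4Continuum.HistoryGenealogyExtraction
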